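import Summits.QuantumFields.GaugeBoot.OneOverNLimit
import HarnessLib

/-!
# The first-order `1/N` correction: its equation, its a priori bound, and its uniqueness (gauge-boot, ADDENDUM 29 part C)

HONEST FRAMING (cell `pub-gaugeboot`, page 1 of every file): the venture produces certified bounds
on lattice expectations at stated coupling, gauge group, dimension and torus size; NOT a mass gap,
NOT a continuum limit, NOT a string tension; NOT Yang–Mills-summit-bearing (barriers
`FixedCouplingUltralocality`, `PerturbativeInvisibility`).  Strong-coupling `SO(N)` lattice gauge theory with free boundary
condition (S. Chatterjee, Comm. Math. Phys. **366** (2019); `1/N` expansion: Chatterjee–Jafarov); nothing about four-dimensional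
continuum Yang–Mills or a mass gap.

## Content

★★★ `firstOrderCorrection_spec` — for `|β| ≤ β₀(d)` and cubes `[−M_N, M_N]^d` growing faster than `log N`, the limit
`ψ_β(s) = lim_N N(φ_{Λ_N,N,β}(s) − Σ_X w_β(X))` of the sibling `OneOverNLimit` (i) exists for every loop sequence, (ii) vanishes at `∅`,
(iii) is bounded by `C·L^{|s|}` on genuine loop sequences, and (iv) solves the LINEARISED SYMMETRIZED MASTER LOOP EQUATION WITH SOURCE

  `|s| ψ(s) = Σ_{𝕊⁻} ψ − Σ_{𝕊⁺} ψ + β Σ_{𝔻⁻} ψ − β Σ_{𝔻⁺} ψ + ( |s| T(s) + Σ_{𝕋⁻(s)} T − Σ_{𝕋⁺(s)} T )`,  `T = Σ_X w_β(X)`,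

obtained by passing to the limit in the exact finite-`N` equation (`psi_equation`).  ★ `sourced_symmetrized_unique` — two functions of
class `M L^{|s|}` with the same value at `∅` solving this sourced equation coincide (`symmetrized_unique` applied to the difference);
hence ★★ `firstOrderCorrection_indep`: the first-order correction does NOT depend on the admissible sequence of cubes;
★★★ `firstOrderCorrection` packages everything: ONE function `ψ : ℝ → 𝒮 → ℝ` serving every admissible sequence of cubes.

Everything is `[folklore]` given ADDENDA 28–29B.
-/

noncomputable section

open Filter Topology
open Literature.Probability.LatticeModels (Site box)
open Literature.MathematicalPhysics.QuantumLattice (ZdEdge ZdPlaquette)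
open Literature.MathematicalPhysics.QuantumFieldTheory (latticeNorm)
open Literature.MathematicalPhysics.QuantumFieldTheory.Chatterjee2019LargeN
open Literature.MathematicalPhysics.QuantumFieldTheory.Chatterjee2019LargeN.CoeffCatalanBoundProof

namespace Summit.QuantumFields.GaugeBoot

namespace StringDuality

variable {d : ℕ}

/-! ## Uniqueness for the sourced symmetrized equation -/

/-- ★ **Uniqueness for the sourced symmetrized equation**: for `|β| ≤ β₀(M, L, d)` two functions of class `M L^{|s|}`, equal at
`∅`, solving `|s| f(s) − (Σ_{𝕊⁻} f − Σ_{𝕊⁺} f + βΣ_{𝔻⁻} f − βΣ_{𝔻⁺} f) = G(s)` with the same source `G` agree on genuine loop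
sequences. [cite: Chatterjee2019LargeN, Theorem 9.2 (uniqueness), Theorem 9.9] -/
theorem sourced_symmetrized_unique {M L : ℝ} (hM : 0 ≤ M) (hL : 1 ≤ L) :
    ∃ β₀ : ℝ, 0 < β₀ ∧ ∀ β : ℝ, |β| ≤ β₀ → ∀ (G : LoopSeq d → ℝ) (ψ ψ' : LoopSeq d → ℝ), ψ [] = ψ' [] →
      (∀ s : LoopSeq d, IsLoopSeq s → |ψ s| ≤ M * L ^ s.len) →
      (∀ s : LoopSeq d, IsLoopSeq s → |ψ' s| ≤ M * L ^ s.len) →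
      (∀ s : LoopSeq d, IsLoopSeq s → s ≠ [] →
          (s.len : ℝ) * ψ s -
            ((∑ o : InvIdx s, ψ (s.negSplitAt o)) - (∑ o : SameIdx s, ψ (s.posSplitAt o))
              + β * (∑ o : DeformIdx s, ψ (s.negDeformAt o)) - β * (∑ o : DeformIdx s, ψ (s.posDeformAt o))) = G s) →
      (∀ s : LoopSeq d, IsLoopSeq s → s ≠ [] →
          (s.len : ℝ) * ψ' s -
            ((∑ o : InvIdx s, ψ' (s.negSplitAt o)) - (∑ o : SameIdx s, ψ' (s.posSplitAt o))
              + β * (∑ o : DeformIdx s, ψ' (s.negDeformAt o)) - β * (∑ o : DeformIdx s, ψ' (s.posDeformAt o))) = G s) →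
      ∀ s : LoopSeq d, IsLoopSeq s → ψ s = ψ' s := by
  obtain ⟨β₀, hβ₀, H⟩ := symmetrized_unique (d := d) (M := 2 * M) (L := L) (by positivity) hL
  refine ⟨β₀, hβ₀, fun β hβ G ψ ψ' h0 hb hb' he he' s hs => ?_⟩
  -- the difference solves the homogeneous equation; compare it with the zero function
  have h := H β hβ (fun t => ψ t - ψ' t) (fun _ => 0) (by simp [h0])
    (fun t ht => by
      calc |ψ t - ψ' t| ≤ |ψ t| + |ψ' t| := abs_sub _ _
        _ ≤ M * L ^ t.len + M * L ^ t.len := add_le_add (hb t ht) (hb' t ht)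
        _ = 2 * M * L ^ t.len := by ring)
    (fun t _ => by rw [abs_zero]; positivity)
    (fun t ht htne => by
      have h1 := he t ht htne
      have h2 := he' t ht htne
      simp only [Finset.sum_sub_distrib]
      linarith)
    (fun t _ _ => by simp) s hs
  linarith

/-! ## The equation of the first-order correction -/

variable (d)

/-- ★★★ **The first-order `1/N` correction: existence, a priori bound and equation.**  For `d ≥ 2` there are `β₀(d) > 0`, `C, L`
such that for every monotone `M` with `M_N → ∞`, `N(3/4)^{M_N} → 0` and every `|β| ≤ β₀` there is `ψ : 𝒮 → ℝ` with:
`N(φ_{Λ_N,N,β}(s) − T(s)) → ψ(s)` for every genuine `s`; `ψ(∅) = 0`; `|ψ(s)| ≤ C L^{|s|}`; and `ψ` solves the linearised symmetrized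
master loop equation with source `|s|T(s) + Σ_{𝕋⁻(s)}T − Σ_{𝕋⁺(s)}T`.
[cite: Chatterjee2019LargeN, Theorem 3.6, Theorem 9.9, Theorem 3.1 (ingredients); first-order 1/N expansion (Chatterjee–Jafarov)] -/
theorem firstOrderCorrection_spec (hd : 2 ≤ d) :
    ∃ β₀ : ℝ, 0 < β₀ ∧ ∃ C L : ℝ, 0 ≤ C ∧ 1 ≤ L ∧ ∀ M : ℕ → ℕ, Monotone M → Tendsto M atTop atTop →
      Tendsto (fun N : ℕ => (N : ℝ) * (3 / 4 : ℝ) ^ M N) atTop (𝓝 0) →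
        ∀ β : ℝ, |β| ≤ β₀ → ∃ ψ : LoopSeq d → ℝ,
          (∀ s : LoopSeq d, IsLoopSeq s → Tendsto (fun N : ℕ => (N : ℝ) *
            (phi N β (box d (M N)) s - ∑' X : Trajectory s, X.weight β)) atTop (𝓝 (ψ s))) ∧
          ψ [] = 0 ∧
          (∀ s : LoopSeq d, IsLoopSeq s → |ψ s| ≤ C * L ^ s.len) ∧
          (∀ s : LoopSeq d, IsLoopSeq s → s ≠ [] →
            (s.len : ℝ) * ψ s -
              ((∑ o : InvIdx s, ψ (s.negSplitAt o)) - (∑ o : SameIdx s, ψ (s.posSplitAt o))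
                + β * (∑ o : DeformIdx s, ψ (s.negDeformAt o)) - β * (∑ o : DeformIdx s, ψ (s.posDeformAt o))) =
              (s.len : ℝ) * (∑' X : Trajectory s, X.weight β)
                + ((∑ o : SameIdx s, ∑' X : Trajectory (s.negTwistAt o), X.weight β)
                  - ∑ o : InvIdx s, ∑' X : Trajectory (s.posTwistAt o), X.weight β)) := by
  obtain ⟨β₁, hβ₁, K₁, hK₁, HR⟩ := abs_phi_sub_trajectorySum_le d hd
  obtain ⟨β₂, hβ₂, H2⟩ := tendsto_firstOrderCorrection d hd
  obtain ⟨β₃, hβ₃, H3⟩ := gaugeStringDuality_holds d hd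
  have hβT : (0 : ℝ) < 1 / (2 * bigK d ^ 5) := by have := one_le_bigK d; positivity
  refine ⟨min (min β₁ β₂) (min β₃ (1 / (2 * bigK d ^ 5))), lt_min (lt_min hβ₁ hβ₂) (lt_min hβ₃ hβT), 21, 4 * K₁,
    by norm_num, by linarith, fun M hMmono hM hgrowth β hβ => ?_⟩
  have hb1 : |β| ≤ β₁ := hβ.trans ((min_le_left _ _).trans (min_le_left _ _))
  have hb2 : |β| ≤ β₂ := hβ.trans ((min_le_left _ _).trans (min_le_right _ _))
  have hb3 : |β| ≤ β₃ := hβ.trans ((min_le_right _ _).trans (min_le_left _ _))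
  have hbT : |β| ≤ 1 / (2 * bigK d ^ 5) := hβ.trans ((min_le_right _ _).trans (min_le_right _ _))
  set T : LoopSeq d → ℝ := fun t => ∑' X : Trajectory t, X.weight β with hT
  set φ : ℕ → LoopSeq d → ℝ := fun N t => phi N β (box d (M N)) t with hφ
  set ψN : ℕ → LoopSeq d → ℝ := fun N t => (N : ℝ) * (φ N t - T t) with hψN
  -- the limit function
  set ψ : LoopSeq d → ℝ := fun t => limUnder atTop (fun N : ℕ => ψN N t) with hψdef
  have hψ : ∀ t : LoopSeq d, IsLoopSeq t → Tendsto (fun N => ψN N t) atTop (𝓝 (ψ t)) :=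
    fun t ht => tendsto_nhds_limUnder (H2 M hMmono hM hgrowth β hb2 t ht)
  have hexh : IsExhaustion fun N => box d (M N) := by
    refine ⟨fun m n hmn => isExhaustion_box.1 (hMmono hmn), fun x => ?_⟩
    obtain ⟨n, hn⟩ := isExhaustion_box (d := d) |>.2 x
    obtain ⟨N, hN⟩ := (tendsto_atTop.mp hM n).exists
    exact ⟨N, isExhaustion_box.1 hN hn⟩
  have hφT : ∀ t, IsLoopSeq t → Tendsto (fun N => φ N t) atTop (𝓝 (T t)) := fun t ht => (H3 _ hexh β hb3 t ht).2
  have hnil : IsLoopSeq ([] : LoopSeq d) := fun l hl => by simp at hl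
  refine ⟨ψ, fun s hs => hψ s hs, ?_, ?_, ?_⟩
  -- (ii) `ψ(∅) = 0`
  · have h0 : ∀ N, ψN N [] = 0 := fun N => by
      simp only [hψN, hφ, hT, phi_nil, trajectorySum_nil, sub_self, mul_zero]
    have := hψ [] hnil
    simp_rw [h0] at this
    exact (tendsto_nhds_unique this tendsto_const_nhds)
  -- (iii) the a priori bound
  · intro s hs
    obtain ⟨r, hr⟩ := exists_vertices_mem_box s
    have hev : ∀ᶠ N : ℕ in atTop, |ψN N s| ≤ 21 * (K₁ ^ s.index * catProd s) := by
      have e1 : ∀ᶠ N : ℕ in atTop, 2 ≤ N := eventually_ge_atTop 2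
      have e2 : ∀ᶠ N : ℕ in atTop, r + 1 ≤ M N := (tendsto_atTop.mp hM) _
      have e3 : ∀ᶠ N : ℕ in atTop, 3 * (N : ℝ) * (3 / 4 : ℝ) ^ (M N - r) ≤ 1 := by
        have h := hgrowth.const_mul (3 * (4 / 3 : ℝ) ^ r)
        rw [mul_zero] at h
        filter_upwards [h.eventually (ge_mem_nhds (by norm_num : (0 : ℝ) < 1)), e2] with N hN hMN
        have hsplit : (3 / 4 : ℝ) ^ M N = (3 / 4 : ℝ) ^ (M N - r) * (3 / 4 : ℝ) ^ r := by
          rw [← pow_add]; congr 1; omega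
        have h43 : (4 / 3 : ℝ) ^ r * (3 / 4 : ℝ) ^ r = 1 := by rw [← mul_pow]; norm_num
        have : 3 * (4 / 3 : ℝ) ^ r * ((N : ℝ) * (3 / 4 : ℝ) ^ M N) = 3 * (N : ℝ) * (3 / 4 : ℝ) ^ (M N - r) := by
          rw [hsplit]
          calc 3 * (4 / 3 : ℝ) ^ r * ((N : ℝ) * ((3 / 4 : ℝ) ^ (M N - r) * (3 / 4 : ℝ) ^ r))
              = 3 * (N : ℝ) * (3 / 4 : ℝ) ^ (M N - r) * ((4 / 3 : ℝ) ^ r * (3 / 4 : ℝ) ^ r) := by ring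
            _ = _ := by rw [h43, mul_one]
        rw [this] at hN; exact hN
      filter_upwards [e1, e2, e3] with N hN2 hMN hdep
      have hne : (box d (M N)).Nonempty := Finset.card_pos.mp (card_box_pos (M N))
      have hball := ball_of_vertices_mem_box (n := M N - r) (M := M N) (by omega) hr
      have h := HR (box d (M N)) hne N hN2 β hb1
        (fun m u => ∀ l ∈ u, ∀ a ∈ l, ∀ v : Site d,
          latticeNorm (v - DEdge.src a) ≤ (m : ℕ) ∨ latticeNorm (v - DEdge.tgt a) ≤ (m : ℕ) → v ∈ box d (M N))
        (fun m u hu => ball_compatible (box d (M N)) m u hu) (M N - r) s hs hball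
      have hN0 : (0 : ℝ) < N := by exact_mod_cast (by omega : 0 < N)
      have hΦ0 : 0 ≤ K₁ ^ s.index * catProd s := mul_nonneg (pow_nonneg (by linarith) _) (catProd_nonneg _)
      calc |ψN N s| = (N : ℝ) * |φ N s - T s| := by rw [hψN]; simp only; rw [abs_mul, abs_of_pos hN0]
        _ ≤ (N : ℝ) * ((3 * (3 / 4 : ℝ) ^ (M N - r) + 20 / N) * (K₁ ^ s.index * catProd s)) :=
            mul_le_mul_of_nonneg_left h hN0.le
        _ = (3 * (N : ℝ) * (3 / 4 : ℝ) ^ (M N - r) + 20) * (K₁ ^ s.index * catProd s) := by field_simp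
        _ ≤ 21 * (K₁ ^ s.index * catProd s) := mul_le_mul_of_nonneg_right (by linarith) hΦ0
    have hΦle : K₁ ^ s.index * catProd s ≤ (4 * K₁) ^ s.len := by
      calc K₁ ^ s.index * catProd s ≤ K₁ ^ s.len * 4 ^ s.len :=
            mul_le_mul (pow_le_pow_right₀ hK₁ (Nat.sub_le _ _)) (catProd_le_four_pow s) (catProd_nonneg s)
              (by positivity)
        _ = (4 * K₁) ^ s.len := by rw [mul_pow, mul_comm]
    have h1 : |ψ s| ≤ 21 * (K₁ ^ s.index * catProd s) := le_of_tendsto (hψ s hs).abs hev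
    linarith [mul_le_mul_of_nonneg_left hΦle (by norm_num : (0 : ℝ) ≤ 21)]
  -- (iv) the equation: pass to the limit in the exact finite-`N` equation
  · intro s hs hne
    have hL : Tendsto (fun N : ℕ => (s.len : ℝ) * ψN N s -
        ((∑ o : InvIdx s, ψN N (s.negSplitAt o)) - (∑ o : SameIdx s, ψN N (s.posSplitAt o))
          + β * (∑ o : DeformIdx s, ψN N (s.negDeformAt o)) - β * (∑ o : DeformIdx s, ψN N (s.posDeformAt o)))) atTop
        (𝓝 ((s.len : ℝ) * ψ s -
          ((∑ o : InvIdx s, ψ (s.negSplitAt o)) - (∑ o : SameIdx s, ψ (s.posSplitAt o))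
            + β * (∑ o : DeformIdx s, ψ (s.negDeformAt o)) - β * (∑ o : DeformIdx s, ψ (s.posDeformAt o))))) :=
      (tendsto_const_nhds.mul (hψ s hs)).sub
        ((((tendsto_finsetSum _ fun o _ => hψ _ (hs.negSplitAt o)).sub
          (tendsto_finsetSum _ fun o _ => hψ _ (hs.posSplitAt o))).add
          (tendsto_const_nhds.mul (tendsto_finsetSum _ fun o _ => hψ _ (hs.negDeformAt o)))).sub
          (tendsto_const_nhds.mul (tendsto_finsetSum _ fun o _ => hψ _ (hs.posDeformAt o))))
    have hR : Tendsto (fun N : ℕ => (s.len : ℝ) * φ N s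
        + ((∑ o : SameIdx s, φ N (s.negTwistAt o)) - ∑ o : InvIdx s, φ N (s.posTwistAt o))
        + (1 / (N : ℝ)) * ((∑ o : MergeIdx s, φ N (s.negMergeAt o)) - ∑ o : MergeIdx s, φ N (s.posMergeAt o))) atTop
        (𝓝 ((s.len : ℝ) * T s + ((∑ o : SameIdx s, T (s.negTwistAt o)) - ∑ o : InvIdx s, T (s.posTwistAt o))
          + 0 * ((∑ o : MergeIdx s, T (s.negMergeAt o)) - ∑ o : MergeIdx s, T (s.posMergeAt o)))) := by
      refine ((tendsto_const_nhds.mul (hφT s hs)).add ((tendsto_finsetSum _ fun o _ => hφT _ (hs.negTwistAt o)).sub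
        (tendsto_finsetSum _ fun o _ => hφT _ (hs.posTwistAt o)))).add ?_
      exact tendsto_one_div_atTop_nhds_zero_nat.mul ((tendsto_finsetSum _ fun o _ => hφT _ (hs.negMergeAt o)).sub
        (tendsto_finsetSum _ fun o _ => hφT _ (hs.posMergeAt o)))
    have heq : (fun N : ℕ => (s.len : ℝ) * ψN N s -
        ((∑ o : InvIdx s, ψN N (s.negSplitAt o)) - (∑ o : SameIdx s, ψN N (s.posSplitAt o))
          + β * (∑ o : DeformIdx s, ψN N (s.negDeformAt o)) - β * (∑ o : DeformIdx s, ψN N (s.posDeformAt o)))) =ᶠ[atTop]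
        (fun N : ℕ => (s.len : ℝ) * φ N s
          + ((∑ o : SameIdx s, φ N (s.negTwistAt o)) - ∑ o : InvIdx s, φ N (s.posTwistAt o))
          + (1 / (N : ℝ)) * ((∑ o : MergeIdx s, φ N (s.negMergeAt o)) - ∑ o : MergeIdx s, φ N (s.posMergeAt o))) := by
      filter_upwards [eventually_ge_atTop 2, hexh.eventually_vertices_mem s] with N hN2 hV
      have hne' : (box d (M N)).Nonempty := Finset.card_pos.mp (card_box_pos (M N))
      have e := psi_equation hd hne' hN2 hbT hs hne hV
      simp only at e
      exact e
    have h := tendsto_nhds_unique (hL.congr' heq) hR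
    rw [zero_mul, add_zero] at h
    exact h

/-- ★★ **The first-order correction does not depend on the sequence of cubes**: for `|β| ≤ β₀(d)`, two admissible cube
sequences give the same limit `lim_N N(φ_{Λ_N,N,β}(s) − T(s))` for every genuine `s` (both limits solve the same sourced equation in
the same class; `sourced_symmetrized_unique`). [cite: Chatterjee2019LargeN, Theorem 9.2 (uniqueness); first-order 1/N expansion (Chatterjee–Jafarov)] -/
theorem firstOrderCorrection_indep (hd : 2 ≤ d) :
    ∃ β₀ : ℝ, 0 < β₀ ∧ ∀ M M' : ℕ → ℕ, Monotone M → Tendsto M atTop atTop →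
      Tendsto (fun N : ℕ => (N : ℝ) * (3 / 4 : ℝ) ^ M N) atTop (𝓝 0) → Monotone M' → Tendsto M' atTop atTop →
      Tendsto (fun N : ℕ => (N : ℝ) * (3 / 4 : ℝ) ^ M' N) atTop (𝓝 0) →
        ∀ β : ℝ, |β| ≤ β₀ → ∀ s : LoopSeq d, IsLoopSeq s → ∀ a b : ℝ,
          Tendsto (fun N : ℕ => (N : ℝ) * (phi N β (box d (M N)) s - ∑' X : Trajectory s, X.weight β)) atTop (𝓝 a) →
          Tendsto (fun N : ℕ => (N : ℝ) * (phi N β (box d (M' N)) s - ∑' X : Trajectory s, X.weight β)) atTop (𝓝 b) →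
            a = b := by
  obtain ⟨β₁, hβ₁, C, L, hC, hL, H⟩ := firstOrderCorrection_spec d hd
  obtain ⟨β₂, hβ₂, U⟩ := sourced_symmetrized_unique (d := d) hC hL
  refine ⟨min β₁ β₂, lt_min hβ₁ hβ₂, fun M M' hM1 hM2 hM3 hM1' hM2' hM3' β hβ s hs a b ha hb => ?_⟩
  have hb1 : |β| ≤ β₁ := hβ.trans (min_le_left _ _)
  have hb2 : |β| ≤ β₂ := hβ.trans (min_le_right _ _)
  obtain ⟨ψ, hψ, hψ0, hψb, hψe⟩ := H M hM1 hM2 hM3 β hb1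
  obtain ⟨ψ', hψ', hψ0', hψb', hψe'⟩ := H M' hM1' hM2' hM3' β hb1
  have ha' : a = ψ s := tendsto_nhds_unique ha (hψ s hs)
  have hb' : b = ψ' s := tendsto_nhds_unique hb (hψ' s hs)
  rw [ha', hb']
  exact U β hb2 _ ψ ψ' (by rw [hψ0, hψ0']) hψb hψb' hψe hψe' s hs

/-- ★★★ **The first-order `1/N` correction, packaged**: for `d ≥ 2` there are `β₀(d) > 0` and ONE function `ψ : ℝ → 𝒮 → ℝ`
such that for every `|β| ≤ β₀`: `ψ_β(∅) = 0`, `|ψ_β(s)| ≤ C L^{|s|}`, `ψ_β` solves the linearised symmetrized master loop equation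
with source `|s|T + Σ_{𝕋⁻}T − Σ_{𝕋⁺}T`, and along EVERY admissible sequence of cubes (monotone, `M_N → ∞`, `N(3/4)^{M_N} → 0`)
`N(⟨W_{l₁}⋯W_{lₙ}⟩_{Λ_N,N,β}/Nⁿ − Σ_X w_β(X)) → ψ_β(s)` for every genuine loop sequence `s`.
[cite: Chatterjee2019LargeN, Theorems 3.1, 3.6, 9.9 (ingredients); first-order 1/N expansion (Chatterjee–Jafarov)] -/
theorem firstOrderCorrection (hd : 2 ≤ d) :
    ∃ β₀ : ℝ, 0 < β₀ ∧ ∃ C L : ℝ, 0 ≤ C ∧ 1 ≤ L ∧ ∃ ψ : ℝ → LoopSeq d → ℝ, ∀ β : ℝ, |β| ≤ β₀ →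
      ψ β [] = 0 ∧
      (∀ s : LoopSeq d, IsLoopSeq s → |ψ β s| ≤ C * L ^ s.len) ∧
      (∀ s : LoopSeq d, IsLoopSeq s → s ≠ [] →
        (s.len : ℝ) * ψ β s -
          ((∑ o : InvIdx s, ψ β (s.negSplitAt o)) - (∑ o : SameIdx s, ψ β (s.posSplitAt o))
            + β * (∑ o : DeformIdx s, ψ β (s.negDeformAt o)) - β * (∑ o : DeformIdx s, ψ β (s.posDeformAt o))) =
          (s.len : ℝ) * (∑' X : Trajectory s, X.weight β)
            + ((∑ o : SameIdx s, ∑' X : Trajectory (s.negTwistAt o), X.weight β)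
              - ∑ o : InvIdx s, ∑' X : Trajectory (s.posTwistAt o), X.weight β)) ∧
      ∀ M : ℕ → ℕ, Monotone M → Tendsto M atTop atTop →
        Tendsto (fun N : ℕ => (N : ℝ) * (3 / 4 : ℝ) ^ M N) atTop (𝓝 0) →
          ∀ s : LoopSeq d, IsLoopSeq s → Tendsto (fun N : ℕ => (N : ℝ) *
            (phi N β (box d (M N)) s - ∑' X : Trajectory s, X.weight β)) atTop (𝓝 (ψ β s)) := by
  obtain ⟨β₁, hβ₁, C, L, hC, hL, H⟩ := firstOrderCorrection_spec d hd
  obtain ⟨β₂, hβ₂, I⟩ := firstOrderCorrection_indep d hd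
  obtain ⟨β₃, hβ₃, B⟩ := tendsto_firstOrderCorrection d hd
  -- the reference sequence of cubes `M₀ N = N`
  have hid1 : Monotone (fun N : ℕ => N) := fun a b h => h
  have hid2 : Tendsto (fun N : ℕ => N) atTop atTop := tendsto_id
  have hid3 : Tendsto (fun N : ℕ => (N : ℝ) * (3 / 4 : ℝ) ^ (fun N : ℕ => N) N) atTop (𝓝 0) :=
    tendsto_self_mul_const_pow_of_lt_one (by norm_num) (by norm_num)
  refine ⟨min β₁ (min β₂ β₃), lt_min hβ₁ (lt_min hβ₂ hβ₃), C, L, hC, hL,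
    fun β => if h : |β| ≤ β₁ then Classical.choose (H _ hid1 hid2 hid3 β h) else fun _ => 0, fun β hβ => ?_⟩
  have hb1 : |β| ≤ β₁ := hβ.trans (min_le_left _ _)
  have hb2 : |β| ≤ β₂ := hβ.trans ((min_le_right _ _).trans (min_le_left _ _))
  have hb3 : |β| ≤ β₃ := hβ.trans ((min_le_right _ _).trans (min_le_right _ _))
  have hspec := Classical.choose_spec (H _ hid1 hid2 hid3 β hb1)
  simp only [dif_pos hb1]
  refine ⟨hspec.2.1, hspec.2.2.1, hspec.2.2.2, fun M hM1 hM2 hM3 s hs => ?_⟩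
  obtain ⟨a, ha⟩ := B M hM1 hM2 hM3 β hb3 s hs
  have hlim := hspec.1 s hs
  have hEq : a = Classical.choose (H _ hid1 hid2 hid3 β hb1) s := I M _ hM1 hM2 hM3 hid1 hid2 hid3 β hb2 s hs a _ ha hlim
  rw [← hEq]; exact ha

end StringDuality

end Summit.QuantumFields.GaugeBoot

end
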